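import Literature.Geometry.Lorentzian.SpacetimeChartDeviationTransfer
import HarnessLib

/-!
# Transport of chart deviations through a pointed `Cᵏ_loc` convergence
(topic `Geometry/Lorentzian`; the upper-semicontinuity mechanism "push a chart of the limit through
the comparison maps": Petersen 2006, Ch. 10, §3.2; Anderson 2004, Def. 1.1 and §5)

Let `D : (𝓢ₙ, pₙ) ⇀ (𝓢, p)` be a pointed `Cᵏ_loc` subconvergence datum with comparison maps
`φₙ : 𝓢 → 𝓢ₙ`, and let `Ψ : B.domain → 𝓢` be a chart map over a reference background `B`
(`ModelBackground`, `Spacetime.deviationExtend` of `KerrConvergence.lean`), `C^∞` over an open set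
`W ⊆ B.domain`. Then on every COMPACT `K ⊆ W` the `Cᵏ` sup norm of the difference of deviations
`deviationExtend B (φₙ ∘ Ψ) − deviationExtend B Ψ` — the deviation of the pushed chart `φₙ ∘ Ψ`
of `𝓢ₙ` minus the deviation of `Ψ` — tends to `0`
(`LocalSubconvergence.tendsto_supCkENorm_deviationExtend_comp_sub`). Consequently every `Cᵏ`
closeness of `(𝓢, p)` to the background witnessed by `Ψ` on a compact sub-window is inherited,
up to `o(1)`, by `(𝓢ₙ, pₙ)` through `φₙ ∘ Ψ` — the formal core of "window deviations are upper
semicontinuous along a pointed limit". The compactness of `K` and the smoothness of `Ψ` on a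
neighbourhood of `K` are both needed (the transport constant is the `C^{k+1}` size of `c' ∘ Ψ`,
`norm_iteratedFDeriv_bilinPullback_le`).

Also: `LocalSubconvergence.tendsto_supCkENorm_metricInCoords_comp_sub`, the same statement for a
total map `Ψ : E4 → 𝓢` smooth on an open `W` (first-bracket convergence with Euclidean source),
and `chartExtend`, `contMDiffOn_chartExtend`: smoothness of a chart map over an open subset of the
background domain versus smoothness of its total representative on `E4`.

## References
* [Petersen2006] P. Petersen, *Riemannian Geometry*, 2nd ed., GTM 171, Springer 2006, Ch. 10, §3.2.
* [Anderson2004] M. T. Anderson, Cheeger–Gromov theory and applications to general relativity,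
  Birkhäuser 2004, Def. 1.1, §5.
-/

noncomputable section

open TopologicalSpace Manifold Filter Topology Set Function Metric
open scoped ContDiff Topology ENNReal

universe u v

namespace Literature.Geometry.Lorentzian

namespace Spacetime

namespace LocalSubconvergence

variable {𝓢ₙ : ℕ → Spacetime.{u} 4} {pₙ : ∀ n, (𝓢ₙ n).carrier} {𝓢 : Spacetime.{v} 4}
  {p : 𝓢.carrier} {k : ℕ}

/-- **First-bracket convergence with Euclidean source.** For a total map `Ψ : E4 → 𝓢`, `C^∞` on an
open set `W`, and a compact `K ⊆ W`, the `Cᵏ` sup norm over `K` of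
`(φₙ ∘ Ψ)^* gₙ − Ψ^* g` (components on `E4`, `Spacetime.metricInCoords`) tends to `0`: cut `K` into
finitely many compact pieces mapped by `Ψ` into single chart balls of `𝓢`, rewrite the bracket
there as the transported chart deviation of `φₙ` (`metricInCoords_eq_bilinPullback_of_eventuallyEq`)
and use `tendsto_supCkENorm_bilinPullback`. [cite: Petersen2006, Ch. 10 §3.2] -/
theorem tendsto_supCkENorm_metricInCoords_comp_sub (D : LocalSubconvergence 𝓢ₙ pₙ 𝓢 p k)
    {Ψ : E4 → 𝓢.carrier} {W : Set E4} (hW : IsOpen W) (hΨ : ContMDiffOn 𝓘(ℝ, E4) (𝓡 4) ∞ Ψ W)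
    {K : Set E4} (hK : IsCompact K) (hKW : K ⊆ W) :
    Tendsto (fun n ↦ supCkENorm K k
      ((𝓢ₙ (D.sub n)).metricInCoords (D.embed n ∘ Ψ) - 𝓢.metricInCoords Ψ)) atTop (𝓝 0) := by
  classical
  -- chart balls of `𝓢`
  have hrad : ∀ x' : 𝓢.carrier, ∃ r : ℝ, 0 < r ∧
      closedBall (chartAt E4 x' x') r ⊆ (chartAt E4 x').target := fun x' ↦
    Metric.nhds_basis_closedBall.mem_iff.1
      ((chartAt E4 x').open_target.mem_nhds (mem_chart_target E4 x'))
  choose r hr hrt using hrad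
  set O : 𝓢.carrier → Set E4 := fun x' ↦ W ∩ Ψ ⁻¹'
    ((chartAt E4 x').source ∩ chartAt E4 x' ⁻¹' ball (chartAt E4 x' x') (r x')) with hO
  have hOo : ∀ x', IsOpen (O x') := fun x' ↦
    hΨ.continuousOn.isOpen_inter_preimage hW
      ((chartAt E4 x').continuousOn.isOpen_inter_preimage (chartAt E4 x').open_source isOpen_ball)
  have hKO : K ⊆ ⋃ x', O x' := fun y hy ↦
    mem_iUnion.2 ⟨Ψ y, hKW hy, mem_chart_source E4 _, mem_ball_self (hr _)⟩
  obtain ⟨S, ε, hSO, hKS⟩ := exists_finset_closedBall_pieces_of_isCompact hK O hOo hKO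
  set P : E4 → Set E4 := fun y ↦ K ∩ closedBall y (ε y) with hP
  have hPc : ∀ y, IsCompact (P y) := fun y ↦ hK.inter_right isClosed_closedBall
  have hPK : ∀ y, P y ⊆ K := fun y ↦ inter_subset_left
  set Φ : ℕ → E4 → E4 →L[ℝ] E4 →L[ℝ] ℝ := fun n ↦
    (𝓢ₙ (D.sub n)).metricInCoords (D.embed n ∘ Ψ) - 𝓢.metricInCoords Ψ with hΦ
  have hpiece : ∀ y ∈ S, Tendsto (fun n ↦ supCkENorm (P y) k (Φ n)) atTop (𝓝 0) := by
    intro y hy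
    obtain ⟨x', hPO⟩ := hSO y hy
    set c' := chartAt E4 x' with hc'
    -- the transition `θ = c' ∘ Ψ`, smooth on the open set `s`
    set θ : E4 → E4 := c' ∘ Ψ with hθ
    set s : Set E4 := W ∩ Ψ ⁻¹' c'.source with hs
    have hso : IsOpen s := hΨ.continuousOn.isOpen_inter_preimage hW c'.open_source
    have hθs : ContDiffOn ℝ ∞ θ s := by
      rw [← contMDiffOn_iff_contDiffOn]
      exact (contMDiffOn_chart (x := x')).comp (hΨ.mono inter_subset_left) fun y hy ↦ hy.2
    have hPs : P y ⊆ s := fun y' hy' ↦ ⟨(hPO hy').1, (hPO hy').2.1⟩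
    have hθP : MapsTo θ (P y) (closedBall (c' x') (r x')) := fun y' hy' ↦
      ball_subset_closedBall (hPO hy').2.2
    have hB : ∀ᶠ n in atTop, ∃ t' : Set E4, IsOpen t' ∧ closedBall (c' x') (r x') ⊆ t' ∧
        ContDiffOn ℝ k (D.coordDeviation n x') t' := by
      have hC : IsCompact (c'.symm '' closedBall (c' x') (r x')) :=
        (isCompact_closedBall _ _).image_of_continuousOn (c'.continuousOn_symm.mono (hrt x'))
      filter_upwards [D.eventually_subset_U hC] with n hn
      refine ⟨c'.target ∩ c'.symm ⁻¹' (D.U n : Set 𝓢.carrier),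
        c'.continuousOn_symm.isOpen_inter_preimage c'.open_target (D.U n).isOpen,
        fun y' hy' ↦ ⟨hrt x' hy', hn (mem_image_of_mem _ hy')⟩, ?_⟩
      rw [D.coordDeviation_eq_chartDeviation]
      exact (contDiffOn_chartDeviation _ (D.U n).isOpen (D.contMDiffOn_embed n) x').of_le
        (by exact_mod_cast le_top)
    have hlim := tendsto_supCkENorm_bilinPullback hso
      ((hθs.of_le (by exact_mod_cast le_top)) : ContDiffOn ℝ (k + 1) θ s) (hPc y) hPs hθP hB
      (D.tendsto_supCkENorm_coordDeviation x' (isCompact_closedBall _ _) (hrt x'))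
    -- the germ identity on the piece, eventually
    have hgerm : ∀ᶠ n in atTop, ∀ y' ∈ P y,
        Φ n =ᶠ[𝓝 y'] bilinPullback θ (D.coordDeviation n x') := by
      have hC : IsCompact (Ψ '' K) := hK.image_of_continuousOn (hΨ.continuousOn.mono hKW)
      filter_upwards [D.eventually_subset_U hC] with n hn y' hy'
      set s' : Set E4 := W ∩ Ψ ⁻¹' (c'.source ∩ (D.U n : Set 𝓢.carrier)) with hs'
      have hs'o : IsOpen s' :=
        hΨ.continuousOn.isOpen_inter_preimage hW (c'.open_source.inter (D.U n).isOpen)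
      have hy's' : y' ∈ s' :=
        ⟨(hPO hy').1, (hPO hy').2.1, hn (mem_image_of_mem _ (hPK y hy'))⟩
      filter_upwards [hs'o.mem_nhds hy's'] with y'' hy''
      obtain ⟨h1, h2, h3⟩ := hy''
      have hΨd : MDifferentiableAt 𝓘(ℝ, E4) (𝓡 4) Ψ y'' :=
        ((hΨ _ h1).contMDiffAt (hW.mem_nhds h1)).mdifferentiableAt (by simp)
      have hΨc : ContinuousAt Ψ y'' := hΨd.continuousAt
      have hθd : DifferentiableAt ℝ θ y'' := by
        rw [← mdifferentiableAt_iff_differentiableAt]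
        exact (mdifferentiableAt_atlas (chart_mem_atlas E4 x') h2).comp y'' hΨd
      have hsymm : MDifferentiableAt 𝓘(ℝ, E4) (𝓡 4) c'.symm (θ y'') :=
        mdifferentiableAt_atlas_symm (chart_mem_atlas E4 x') (c'.map_source h2)
      have hleft : c'.symm (θ y'') = Ψ y'' := c'.left_inv h2
      have hGd : MDifferentiableAt (𝓡 4) (𝓡 4) (D.embed n) (c'.symm (θ y'')) := by
        rw [hleft]
        exact ((D.contMDiffOn_embed n _ h3).contMDiffAt ((D.U n).isOpen.mem_nhds h3)).mdifferentiableAt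
          (by simp)
      -- `Ψ = c'⁻¹ ∘ θ` and `φ ∘ Ψ = (φ ∘ c'⁻¹) ∘ θ` near `y''`
      have hev : ∀ᶠ z in 𝓝 y'', Ψ z ∈ c'.source := hΨc.preimage_mem_nhds (c'.open_source.mem_nhds h2)
      have e1 : Ψ =ᶠ[𝓝 y''] c'.symm ∘ θ := by
        filter_upwards [hev] with z hz
        exact (c'.left_inv hz).symm
      have e2 : D.embed n ∘ Ψ =ᶠ[𝓝 y''] (D.embed n ∘ c'.symm) ∘ θ := by
        filter_upwards [hev] with z hz
        show D.embed n (Ψ z) = D.embed n (c'.symm (c' (Ψ z)))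
        rw [c'.left_inv hz]
      have k1 := (𝓢ₙ (D.sub n)).metricInCoords_eq_bilinPullback_of_eventuallyEq e2
        (hGd.comp _ hsymm) hθd
      have k2 := 𝓢.metricInCoords_eq_bilinPullback_of_eventuallyEq e1 hsymm hθd
      show (𝓢ₙ (D.sub n)).metricInCoords (D.embed n ∘ Ψ) y'' - 𝓢.metricInCoords Ψ y'' =
        bilinPullback θ (D.coordDeviation n x') y''
      rw [k1, k2, ← bilinPullback_sub_apply]
      rfl
    refine (tendsto_congr' ?_).2 hlim
    filter_upwards [hgerm] with n hn
    exact supCkENorm_congr hn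
  have hsum : Tendsto (fun n ↦ ∑ y ∈ S, supCkENorm (P y) k (Φ n)) atTop (𝓝 0) := by
    have h := tendsto_finsetSum S fun y hy ↦ hpiece y hy
    simpa using h
  refine tendsto_of_tendsto_of_tendsto_of_le_of_le tendsto_const_nhds hsum (fun _ ↦ zero_le)
    fun n ↦ ?_
  exact (supCkENorm_mono hKS k _).trans (supCkENorm_biUnion_finset_le S P k _)

/-! ### Chart maps over a background: extension to `E4` and smoothness -/

/-- Smoothness of a map of an open subset `U ⊆ E4` (the open submanifold) at a point versus
smoothness of any total representative at the underlying point (Mathlib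
`contMDiffAt_subtype_iff`). [folklore] -/
theorem contMDiffAt_opens_iff_of_eq {U : Opens E4} {f : U → 𝓢.carrier} {F : E4 → 𝓢.carrier}
    (h : ∀ y : U, f y = F y) (x : U) :
    ContMDiffAt 𝓘(ℝ, E4) (𝓡 4) ∞ f x ↔ ContMDiffAt 𝓘(ℝ, E4) (𝓡 4) ∞ F (x : E4) := by
  have hf : f = fun y : U ↦ F y := funext h
  rw [hf]
  exact contMDiffAt_subtype_iff

/-- The total representative `Ψ.extend` of a chart map `Ψ : B.domain → 𝓢` (junk value `p` off the
domain). [folklore] -/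
def chartExtend (B : ModelBackground) (Ψ : B.domain → 𝓢.carrier) (p : 𝓢.carrier) : E4 → 𝓢.carrier :=
  Function.extend Subtype.val Ψ fun _ ↦ p

/-- On the domain the representative agrees with the chart map. [folklore] -/
theorem chartExtend_coe (B : ModelBackground) (Ψ : B.domain → 𝓢.carrier) (p : 𝓢.carrier)
    (y : B.domain) : chartExtend B Ψ p y = Ψ y :=
  Subtype.val_injective.extend_apply _ _ y

/-- Smoothness of `Ψ` over an open `W ⊆ B.domain` is smoothness of its representative on `W`.
[folklore] -/
theorem contMDiffOn_chartExtend {B : ModelBackground} {Ψ : B.domain → 𝓢.carrier} (p : 𝓢.carrier)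
    {W : Set E4} (hWB : W ⊆ B.domain)
    (hΨ : ContMDiffOn 𝓘(ℝ, E4) (𝓡 4) ∞ Ψ (Subtype.val ⁻¹' W)) (hW : IsOpen W) :
    ContMDiffOn 𝓘(ℝ, E4) (𝓡 4) ∞ (chartExtend B Ψ p) W := by
  intro y hy
  have hy' : (⟨y, hWB hy⟩ : B.domain) ∈ Subtype.val ⁻¹' W := hy
  have hopen : IsOpen (Subtype.val ⁻¹' W : Set B.domain) := hW.preimage continuous_subtype_val
  have hat : ContMDiffAt 𝓘(ℝ, E4) (𝓡 4) ∞ Ψ ⟨y, hWB hy⟩ := (hΨ _ hy').contMDiffAt (hopen.mem_nhds hy')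
  exact ((contMDiffAt_opens_iff_of_eq (fun z ↦ (chartExtend_coe B Ψ p z).symm) _).1 hat).contMDiffWithinAt

/-- **The deviation difference is the first bracket of the representative** (on the domain): for
`y ∈ W`, near `y`,
`deviationExtend B (φ ∘ Ψ) − deviationExtend B Ψ = metricInCoords (φ ∘ Ψ') − metricInCoords Ψ'`
with `Ψ'` the representative, provided `Ψ'` and `φ ∘ Ψ'` are differentiable near `y`. [folklore] -/
theorem deviationExtend_comp_sub_eventuallyEq {𝓢' : Spacetime.{u} 4} (B : ModelBackground)
    {Ψ : B.domain → 𝓢.carrier} (p : 𝓢.carrier) {φ : 𝓢.carrier → 𝓢'.carrier} {W : Set E4}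
    (hW : IsOpen W) (hWB : W ⊆ B.domain) {y : E4} (hy : y ∈ W)
    (hΨ : ∀ z ∈ W, MDifferentiableAt 𝓘(ℝ, E4) (𝓡 4) (chartExtend B Ψ p) z)
    (hφ : ∀ z ∈ W, MDifferentiableAt (𝓡 4) (𝓡 4) φ (chartExtend B Ψ p z)) :
    (𝓢'.deviationExtend B (φ ∘ Ψ) - 𝓢.deviationExtend B Ψ) =ᶠ[𝓝 y]
      (𝓢'.metricInCoords (φ ∘ chartExtend B Ψ p) - 𝓢.metricInCoords (chartExtend B Ψ p)) := by
  filter_upwards [hW.mem_nhds hy] with z hz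
  have hzB : z ∈ B.domain := hWB hz
  have e1 : 𝓢.deviationExtend B Ψ z = 𝓢.metricInCoords (chartExtend B Ψ p) z - B.bilin z := by
    rw [show z = ((⟨z, hzB⟩ : B.domain) : E4) from rfl, 𝓢.deviationExtend_coe B Ψ ⟨z, hzB⟩]
    show (show E4 →L[ℝ] E4 →L[ℝ] ℝ from
        pullbackBilin (I := 𝓡 4) (I' := 𝓘(ℝ, E4)) Ψ 𝓢.metric.val ⟨z, hzB⟩) - B.bilin z = _
    have hfun : Ψ = chartExtend B Ψ p ∘ Subtype.val := funext fun w ↦ (chartExtend_coe B Ψ p w).symm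
    have key := 𝓢.pullbackBilin_comp_subtypeVal_eq_metricInCoords (ψ := chartExtend B Ψ p)
      ⟨z, hzB⟩ (hΨ z hz)
    rw [← hfun] at key
    rw [key]
  have e2 : 𝓢'.deviationExtend B (φ ∘ Ψ) z =
      𝓢'.metricInCoords (φ ∘ chartExtend B Ψ p) z - B.bilin z := by
    rw [show z = ((⟨z, hzB⟩ : B.domain) : E4) from rfl, 𝓢'.deviationExtend_coe B (φ ∘ Ψ) ⟨z, hzB⟩]
    show (show E4 →L[ℝ] E4 →L[ℝ] ℝ from
        pullbackBilin (I := 𝓡 4) (I' := 𝓘(ℝ, E4)) (φ ∘ Ψ) 𝓢'.metric.val ⟨z, hzB⟩) - B.bilin z = _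
    have hfun : φ ∘ Ψ = (φ ∘ chartExtend B Ψ p) ∘ Subtype.val :=
      funext fun w ↦ congrArg φ (chartExtend_coe B Ψ p w).symm
    have key := 𝓢'.pullbackBilin_comp_subtypeVal_eq_metricInCoords (ψ := φ ∘ chartExtend B Ψ p)
      ⟨z, hzB⟩ ((hφ z hz).comp z (hΨ z hz))
    rw [← hfun] at key
    rw [key]
  -- evaluate on vectors to avoid heavy instance paths
  ext v w
  have h := congrArg (fun T : E4 →L[ℝ] E4 →L[ℝ] ℝ ↦ T v w) e1
  have h' := congrArg (fun T : E4 →L[ℝ] E4 →L[ℝ] ℝ ↦ T v w) e2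
  simp only [sub_apply] at h h'
  simp only [Pi.sub_apply, sub_apply, h, h']
  ring

/-- **Transport of chart deviations through a pointed `Cᵏ_loc` convergence.** Let
`D : (𝓢ₙ, pₙ) ⇀ (𝓢, p)` be a subconvergence datum with comparison maps `φₙ`, `B` a reference
background, `Ψ : B.domain → 𝓢` a chart map which is `C^∞` over an open `W ⊆ B.domain`, and
`K ⊆ W` compact. Then
`supCkENorm K k (deviationExtend B (φₙ ∘ Ψ) − deviationExtend B Ψ) → 0`: the deviation of the
PUSHED chart `φₙ ∘ Ψ` of `𝓢ₙ` from the background approaches that of `Ψ`, uniformly with `k`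
derivatives on `K` (Petersen 2006, Ch. 10, §3.2; the mechanism behind upper semicontinuity of
window deviations along pointed limits, Anderson 2004, §5). Both the compactness of `K` and the
smoothness of `Ψ` near `K` are used. [cite: Petersen2006, Ch. 10 §3.2] -/
theorem tendsto_supCkENorm_deviationExtend_comp_sub (D : LocalSubconvergence 𝓢ₙ pₙ 𝓢 p k)
    (B : ModelBackground) {Ψ : B.domain → 𝓢.carrier} {W : Set E4} (hW : IsOpen W)
    (hWB : W ⊆ B.domain) (hΨ : ContMDiffOn 𝓘(ℝ, E4) (𝓡 4) ∞ Ψ (Subtype.val ⁻¹' W))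
    {K : Set E4} (hK : IsCompact K) (hKW : K ⊆ W) :
    Tendsto (fun n ↦ supCkENorm K k
      ((𝓢ₙ (D.sub n)).deviationExtend B (D.embed n ∘ Ψ) - 𝓢.deviationExtend B Ψ)) atTop (𝓝 0) := by
  set Ψ' := chartExtend B Ψ p with hΨ'
  have hΨ's : ContMDiffOn 𝓘(ℝ, E4) (𝓡 4) ∞ Ψ' W := contMDiffOn_chartExtend p hWB hΨ hW
  have hlim := D.tendsto_supCkENorm_metricInCoords_comp_sub hW hΨ's hK hKW
  have hΨd : ∀ z ∈ W, MDifferentiableAt 𝓘(ℝ, E4) (𝓡 4) Ψ' z := fun z hz ↦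
    ((hΨ's z hz).contMDiffAt (hW.mem_nhds hz)).mdifferentiableAt (by simp)
  -- eventually, `φₙ` is differentiable on a neighbourhood of `Ψ'(K)`
  have hC : IsCompact (Ψ' '' K) := hK.image_of_continuousOn (hΨ's.continuousOn.mono hKW)
  have hgerm : ∀ᶠ n in atTop, ∀ y ∈ K,
      ((𝓢ₙ (D.sub n)).deviationExtend B (D.embed n ∘ Ψ) - 𝓢.deviationExtend B Ψ) =ᶠ[𝓝 y]
        ((𝓢ₙ (D.sub n)).metricInCoords (D.embed n ∘ Ψ') - 𝓢.metricInCoords Ψ') := by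
    filter_upwards [D.eventually_subset_U hC] with n hn y hy
    set W' : Set E4 := W ∩ Ψ' ⁻¹' (D.U n : Set 𝓢.carrier) with hW'
    have hW'o : IsOpen W' := hΨ's.continuousOn.isOpen_inter_preimage hW (D.U n).isOpen
    have hyW' : y ∈ W' := ⟨hKW hy, hn (mem_image_of_mem _ hy)⟩
    exact deviationExtend_comp_sub_eventuallyEq B p hW'o (inter_subset_left.trans hWB) hyW'
      (fun z hz ↦ hΨd z hz.1) fun z hz ↦
        ((D.contMDiffOn_embed n _ hz.2).contMDiffAt ((D.U n).isOpen.mem_nhds hz.2)).mdifferentiableAt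
          (by simp)
  refine (tendsto_congr' ?_).2 hlim
  filter_upwards [hgerm] with n hn
  exact supCkENorm_congr hn

end LocalSubconvergence

end Spacetime

end Literature.Geometry.Lorentzian
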